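import Summits.RiemannHypothesis.RiemannHypothesis.Theorems.WeilLegendreBlocks136Base
import Summits.RiemannHypothesis.RiemannHypothesis.Theorems.WeilLegendreBlocks136DataDn14
import Literature.NumberTheory.LFunctions.WeilBlockRowsPZ
import HarnessLib

/-!
# Odd Legendre blocks at `nb = 136`: the factored inverse agrees with `D`, rows 68–71

`WeilCert.checkDnRow` for the block base `weilBlocks136Base` with `weilBlocks136Dn/weilBlocks136Ls`, by `decide +kernel`. Pure proof file.
-/

noncomputable section

set_option linter.dupNamespace false

namespace Summit.RiemannHypothesis.RiemannHypothesis.Theorems.EvenWinsBeyondArch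

open Literature.NumberTheory.LFunctions

set_option maxHeartbeats 0 in
/-- Row 68 of `Dn/Ls` is row 68 of `D` (odd blocks, `nb = 136`). [folklore] -/
theorem checkDnRow1_68_weilBlocks136 : weilBlocks136Base.checkDnRow weilBlocks136Dn weilBlocks136Ls 1 68 = true := by
  decide +kernel

set_option maxHeartbeats 0 in
/-- Row 69 of `Dn/Ls` is row 69 of `D` (odd blocks, `nb = 136`). [folklore] -/
theorem checkDnRow1_69_weilBlocks136 : weilBlocks136Base.checkDnRow weilBlocks136Dn weilBlocks136Ls 1 69 = true := by
  decide +kernel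

set_option maxHeartbeats 0 in
/-- Row 70 of `Dn/Ls` is row 70 of `D` (odd blocks, `nb = 136`). [folklore] -/
theorem checkDnRow1_70_weilBlocks136 : weilBlocks136Base.checkDnRow weilBlocks136Dn weilBlocks136Ls 1 70 = true := by
  decide +kernel

set_option maxHeartbeats 0 in
/-- Row 71 of `Dn/Ls` is row 71 of `D` (odd blocks, `nb = 136`). [folklore] -/
theorem checkDnRow1_71_weilBlocks136 : weilBlocks136Base.checkDnRow weilBlocks136Dn weilBlocks136Ls 1 71 = true := by
  decide +kernel


end Summit.RiemannHypothesis.RiemannHypothesis.Theorems.EvenWinsBeyondArch
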